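import Literature.NumberTheory.EllipticCurves.KubertTateSevenMuDescentBox
import Literature.NumberTheory.EllipticCurves.KubertTateSevenRationalTorsion
import HarnessLib

/-!
# `t₇ = 0` at rank `1` by descent alone: the Kubert–Tate `7`-torsion curve `E_{-8} = [-71, 576, 576, 0, 0]`

PROOF-ONLY file (theorems only, no definition, no named fact, no `sorry`), topic
`NumberTheory/EllipticCurves`; an INSTANCE of the `μ₇`-descent box criterion
(`KubertTateSevenMuDescent.shaCorank_seven_eq_zero_of_matrix` and siblings, files
`KubertTateSevenMuDescent[Box]`) on the Kubert–Tate `X₁(7)`-family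
`E_{m,n} : y² + (n² + mn − m²)xy + m²n³(n−m)y = x³ + m²n(n−m)x²`, at `(m, n) = (-8, 1)`:

  `E = E_{-8} = kubertTateSeven (-8) 1 = [-71, 576, 576, 0, 0]`, i.e. `y ^ 2 - 71 * x * y + 576 * y = x ^ 3 + 576 * x ^ 2`,
  `Δ = -2^21·3^14·1063`, `T = (0,0)` of order `7`.

TAME: `7 ∤ Δ` and the bad primes `2, 3, 1063` are `≢ 1 (mod 7)`. BOX: `S = {2, 3}`
(`ω(mn(m−n)) = 2`); the rational points `(-16, 80)`, `(72, -648)` (found by a naive search; the last one is `3T`)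
have `f_T = x²y − n(m+n)x³ + n³(2m+n)xy − m²n⁴x² + m²n⁶y` equal to `-256`, `-419904`, the base point
`2T = (-576, -41472)` has `f_T = -15479341056`; the `2×2` matrix of valuation differences mod `7`,
`M = [[4, 4], [2, 5]]`, is invertible mod `7` (inverse `[[1, 2], [1, 5]]`). Hence, with NO `L`-function, `p`-adic or conjectural input:

* `shaCorank_seven_eq_zero` — **`t₇(E_{-8}) = corank_{ℤ₇} Ш(E/ℚ)[7^∞] = 0`**;
* `sha_torsionBy_seven_eq_bot` — `Ш(E/ℚ)[7] = 0`; `primaryComponent_sha_seven_eq_bot` — `Ш(E/ℚ)[7^∞] = 0`;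
* `mordellWeilRank_eq` — **`rank E_{-8}(ℚ) = 1`** (with `#E(ℚ)[7] = 7` by reduction modulo `5`,
  `KubertTateSevenTorsion.natCard_torsionBy_seven`).

## References

* [SilvermanAEC2009] J. H. Silverman, *AEC*, 2nd ed., Thm. X.4.2, Prop. X.4.9, Exercise 10.1, Thm. X.1.1,
  VII.3.1(b).
* [Fisher2001FiveSevenDescent] T. Fisher, *Some examples of 5 and 7 descent for elliptic curves over ℚ*,
  JEMS 3 (2001), §§1–2 (the family; this member and its points are ours, verified in-file).
* [Kubert1976] D. S. Kubert, *Universal bounds on the torsion of elliptic curves*, Table 3 (`N = 7`).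
-/

noncomputable section

open scoped AddSubgroup
open WeierstrassCurve
open Literature.NumberTheory.EllipticCurves Literature.NumberTheory.EllipticCurves.KubertTateSevenVelu

namespace Literature.NumberTheory.EllipticCurves

namespace KubertTateM81Descent

/-! ## §1 The curve: coefficients, discriminant, tameness -/

/-- `E_{-8} = [-71, 576, 576, 0, 0]`. [cite: Kubert1976, Table 3 (N = 7)] -/
theorem curve_eq : kubertTateSeven (((-8 : ℤ) : ℚ)) (((1 : ℤ) : ℚ)) = ⟨-71, 576, 576, 0, 0⟩ := by
  ext <;> simp [kubertTateSeven] <;> norm_num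

/-- `Δ(E_{-8}) = -10662541623558144` (integer model). [cite: Kubert1976, Table 3 (N = 7)] -/
theorem Δ_int : (kubertTateSeven (-8 : ℤ) 1).Δ = -10662541623558144 := by
  rw [kubertTateSeven_Δ]; norm_num

/-- `E_{-8}` is an elliptic curve (`Δ ≠ 0`). [cite: Kubert1976, Table 3 (N = 7)] -/
theorem isElliptic : (kubertTateSeven (((-8 : ℤ) : ℚ)) (((1 : ℤ) : ℚ))).IsElliptic := by
  refine ⟨isUnit_iff_ne_zero.mpr ?_⟩
  rw [eq_map_int (-8) 1, map_Δ, Δ_int]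
  norm_num

/-- `7 ∤ Δ`: good reduction at `7`. [cite: Fisher2001FiveSevenDescent, §2] -/
theorem not_seven_dvd_Δ : ¬ (7 : ℤ) ∣ (kubertTateSeven (-8 : ℤ) 1).Δ := by
  rw [Δ_int]; norm_num

/-- `5 ∤ Δ`: good reduction at `5` (used for the rational torsion). [cite: SilvermanAEC2009, VII.3.1(b)] -/
theorem not_tor_dvd_Δ : ¬ ((5 : ℕ) : ℤ) ∣ (kubertTateSeven (-8 : ℤ) 1).Δ := by
  rw [Δ_int]; norm_num

/-- **TAME**: every bad prime (`2, 3, 1063`) is `≢ 1 (mod 7)`. [cite: Fisher2001FiveSevenDescent, §2] -/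
theorem tame : ∀ p : ℕ, p.Prime → (p : ℤ) ∣ (kubertTateSeven (-8 : ℤ) 1).Δ → p % 7 ≠ 1 := by
  intro p hp hdvd
  rw [Δ_int] at hdvd
  have hdvdN : p ∣ 2 ^ 21 * 3 ^ 14 * 1063 := by
    have h' : (p : ℤ) ∣ ((2 ^ 21 * 3 ^ 14 * 1063 : ℕ) : ℤ) := by
      have e : ((2 ^ 21 * 3 ^ 14 * 1063 : ℕ) : ℤ) = 10662541623558144 := by norm_num
      rw [e]; exact (Int.dvd_neg.mpr hdvd)
    exact Int.natCast_dvd_natCast.mp h'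
  have hpi := Nat.Prime.prime hp
  rcases hpi.dvd_or_dvd hdvdN with h | h
  · rcases hpi.dvd_or_dvd h with h | h
    · have := (Nat.prime_dvd_prime_iff_eq hp Nat.prime_two).mp (hpi.dvd_of_dvd_pow h); omega
    · have := (Nat.prime_dvd_prime_iff_eq hp Nat.prime_three).mp (hpi.dvd_of_dvd_pow h); omega
  · have := (Nat.prime_dvd_prime_iff_eq hp (by norm_num : Nat.Prime 1063)).mp h; omega

/-- `S = ` the prime factors of `|mn(m − n)| = 72`: `{2, 3}`. [folklore] -/
private theorem primeFactors_eq : ((-8 : ℤ) * 1 * (-8 - 1)).natAbs.primeFactors = {2, 3} := by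
  have e : ((-8 : ℤ) * 1 * (-8 - 1)).natAbs = 2 ^ 3 * 3 ^ 2 := by norm_num
  rw [e]
  ext p
  simp only [Nat.mem_primeFactors, Finset.mem_insert, Finset.mem_singleton]
  constructor
  · rintro ⟨hp, hdvd, -⟩
    have hpi := Nat.Prime.prime hp
    rcases hpi.dvd_or_dvd hdvd with h | h
    · exact Or.inl ((Nat.prime_dvd_prime_iff_eq hp Nat.prime_two).mp (hpi.dvd_of_dvd_pow h))
    · exact Or.inr ((Nat.prime_dvd_prime_iff_eq hp Nat.prime_three).mp (hpi.dvd_of_dvd_pow h))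
  · rintro (rfl | rfl) <;> norm_num

/-! ## §2 The affine equation and the points -/

/-- The affine equation of `E_{-8}`: `y ^ 2 - 71 * x * y + 576 * y = x ^ 3 + 576 * x ^ 2`. [cite: Kubert1976, Table 3 (N = 7)] -/
theorem nonsingular_iff (x y : ℚ) :
    (kubertTateSeven (((-8 : ℤ) : ℚ)) (((1 : ℤ) : ℚ))).toAffine.Nonsingular x y ↔
      y ^ 2 - 71 * x * y + 576 * y = x ^ 3 + 576 * x ^ 2 := by
  have hΔ : (kubertTateSeven (((-8 : ℤ) : ℚ)) (((1 : ℤ) : ℚ))).Δ ≠ 0 := isElliptic.isUnit.ne_zero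
  rw [← Affine.equation_iff_nonsingular_of_Δ_ne_zero hΔ, Affine.equation_iff]
  simp only [kubertTateSeven_a₁, kubertTateSeven_a₂, kubertTateSeven_a₃, kubertTateSeven_a₄,
    kubertTateSeven_a₆]
  push_cast
  constructor <;> intro h <;> linear_combination h

/-- The points `(-16, 80)`, `(72, -648)` and the base point `2T = (-576, -41472)` lie on `E_{-8}`
(checked by `norm_num`). [folklore] -/
private theorem nonsingular_points :
    (kubertTateSeven (((-8 : ℤ) : ℚ)) (((1 : ℤ) : ℚ))).toAffine.Nonsingular (-16) (80) ∧
    (kubertTateSeven (((-8 : ℤ) : ℚ)) (((1 : ℤ) : ℚ))).toAffine.Nonsingular (72) (-648) ∧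
    (kubertTateSeven (((-8 : ℤ) : ℚ)) (((1 : ℤ) : ℚ))).toAffine.Nonsingular (-576) (-41472) := by
  refine ⟨(nonsingular_iff _ _).mpr ?_, (nonsingular_iff _ _).mpr ?_, (nonsingular_iff _ _).mpr ?_⟩ <;> norm_num

/-! ## §3 The valuation matrix -/

/-- `v_p(± p^k u) = k` for `p ∤ u` (evaluation of `padicValRat` on a factorised integer). [folklore] -/
private theorem padicValRat_eq_of_eq {p : ℕ} [hp : Fact p.Prime] {a : ℚ} (k : ℕ) {u : ℕ} (s : ℤ)
    (hs : s = 1 ∨ s = -1) (hu : ¬ p ∣ u) (h : a = s * (p : ℚ) ^ k * u) : padicValRat p a = k := by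
  have hu0 : u ≠ 0 := by rintro rfl; exact hu (dvd_zero p)
  have hp0 : (p : ℚ) ≠ 0 := Nat.cast_ne_zero.mpr hp.out.ne_zero
  have hs0 : (s : ℚ) ≠ 0 := by rcases hs with rfl | rfl <;> norm_num
  have hsv : padicValRat p (s : ℚ) = 0 := by
    rcases hs with rfl | rfl
    · simp
    · rw [Int.cast_neg, Int.cast_one, padicValRat.neg, padicValRat.one]
  rw [h, padicValRat.mul (mul_ne_zero hs0 (pow_ne_zero _ hp0)) (Nat.cast_ne_zero.mpr hu0),
    padicValRat.mul hs0 (pow_ne_zero _ hp0), hsv, padicValRat.pow (p : ℚ),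
    padicValRat.self hp.out.one_lt, padicValRat.of_nat, padicValNat.eq_zero_of_not_dvd hu]
  simp

/-- The `f_T`-values of the points (`-256`, `-419904`) and of the base point `2T` (`-15479341056`).
[cite: SilvermanAEC2009, Exercise 10.1(c)] -/
theorem kummerValues :
    (∀ i : Fin 2, ![(-16 : ℚ), 72] i ^ 2 * ![(80 : ℚ), -648] i - (((1 : ℤ) : ℚ)) * ((((-8 : ℤ) : ℚ)) + (((1 : ℤ) : ℚ))) * ![(-16 : ℚ), 72] i ^ 3 + (((1 : ℤ) : ℚ)) ^ 3 * (2 * (((-8 : ℤ) : ℚ)) + (((1 : ℤ) : ℚ))) * ![(-16 : ℚ), 72] i * ![(80 : ℚ), -648] i - (((-8 : ℤ) : ℚ)) ^ 2 * (((1 : ℤ) : ℚ)) ^ 4 * ![(-16 : ℚ), 72] i ^ 2 + (((-8 : ℤ) : ℚ)) ^ 2 * (((1 : ℤ) : ℚ)) ^ 6 * ![(80 : ℚ), -648] i = ![(-256 : ℚ), -419904] i) ∧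
    ((-576 : ℚ) ^ 2 * (-41472) - (((1 : ℤ) : ℚ)) * ((((-8 : ℤ) : ℚ)) + (((1 : ℤ) : ℚ))) * (-576 : ℚ) ^ 3 + (((1 : ℤ) : ℚ)) ^ 3 * (2 * (((-8 : ℤ) : ℚ)) + (((1 : ℤ) : ℚ))) * (-576 : ℚ) * (-41472) - (((-8 : ℤ) : ℚ)) ^ 2 * (((1 : ℤ) : ℚ)) ^ 4 * (-576 : ℚ) ^ 2 + (((-8 : ℤ) : ℚ)) ^ 2 * (((1 : ℤ) : ℚ)) ^ 6 * (-41472) = (-15479341056 : ℚ)) := by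
  refine ⟨fun i ↦ ?_, by norm_num⟩
  fin_cases i <;> simp <;> norm_num

/-- The valuations at `S = (2, 3)`: rows `[[8, 0], [6, 8]]` for the points and `[18, 10]` for the base
point `2T`. [cite: SilvermanAEC2009, Exercise 10.1(c)] -/
theorem valuations :
    (∀ i j : Fin 2, padicValRat (![2, 3] j) (![(-256 : ℚ), -419904] i) = ((![![8, 0], ![6, 8]] i j : ℕ) : ℤ)) ∧
    (∀ j : Fin 2, padicValRat (![2, 3] j) ((-15479341056 : ℚ)) = ((![18, 10] j : ℕ) : ℤ)) := by
  haveI : Fact (Nat.Prime 2) := ⟨Nat.prime_two⟩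
  haveI : Fact (Nat.Prime 3) := ⟨Nat.prime_three⟩
  refine ⟨fun i j ↦ ?_, fun j ↦ ?_⟩
  · fin_cases i <;> fin_cases j
    · exact padicValRat_eq_of_eq (p := 2) 8 (u := 1) (-1) (Or.inr rfl) (by norm_num) (by norm_num)
    · exact padicValRat_eq_of_eq (p := 3) 0 (u := 256) (-1) (Or.inr rfl) (by norm_num) (by norm_num)
    · exact padicValRat_eq_of_eq (p := 2) 6 (u := 6561) (-1) (Or.inr rfl) (by norm_num) (by norm_num)
    · exact padicValRat_eq_of_eq (p := 3) 8 (u := 64) (-1) (Or.inr rfl) (by norm_num) (by norm_num)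
  · fin_cases j
    · exact padicValRat_eq_of_eq (p := 2) 18 (u := 59049) (-1) (Or.inr rfl) (by norm_num) (by norm_num)
    · exact padicValRat_eq_of_eq (p := 3) 10 (u := 262144) (-1) (Or.inr rfl) (by norm_num) (by norm_num)

/-- **The valuation matrix mod `7` is invertible**: with `M_{ij} = v_{q_j} f_T(P_i) − v_{q_j} f_T(2T)`,
`M = [[4, 4], [2, 5]]` mod `7` and `[[1, 2], [1, 5]] · M = 1`, so `c ↦ c M` is onto `(ℤ/7)^2`. [folklore] -/
private theorem matrix_surjective : ∀ e : Fin 2 → ZMod 7, ∃ c : Fin 2 → ZMod 7, Matrix.vecMul c (Matrix.of (fun i j : Fin 2 ↦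
      ((padicValRat (![2, 3] j) (![(-16 : ℚ), 72] i ^ 2 * ![(80 : ℚ), -648] i - (((1 : ℤ) : ℚ)) * ((((-8 : ℤ) : ℚ)) + (((1 : ℤ) : ℚ))) * ![(-16 : ℚ), 72] i ^ 3 + (((1 : ℤ) : ℚ)) ^ 3 * (2 * (((-8 : ℤ) : ℚ)) + (((1 : ℤ) : ℚ))) * ![(-16 : ℚ), 72] i * ![(80 : ℚ), -648] i - (((-8 : ℤ) : ℚ)) ^ 2 * (((1 : ℤ) : ℚ)) ^ 4 * ![(-16 : ℚ), 72] i ^ 2 + (((-8 : ℤ) : ℚ)) ^ 2 * (((1 : ℤ) : ℚ)) ^ 6 * ![(80 : ℚ), -648] i) -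
        padicValRat (![2, 3] j) ((-576 : ℚ) ^ 2 * (-41472) - (((1 : ℤ) : ℚ)) * ((((-8 : ℤ) : ℚ)) + (((1 : ℤ) : ℚ))) * (-576 : ℚ) ^ 3 + (((1 : ℤ) : ℚ)) ^ 3 * (2 * (((-8 : ℤ) : ℚ)) + (((1 : ℤ) : ℚ))) * (-576 : ℚ) * (-41472) - (((-8 : ℤ) : ℚ)) ^ 2 * (((1 : ℤ) : ℚ)) ^ 4 * (-576 : ℚ) ^ 2 + (((-8 : ℤ) : ℚ)) ^ 2 * (((1 : ℤ) : ℚ)) ^ 6 * (-41472)) : ℤ) : ZMod 7))) = e := by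
  have hM : Matrix.of (fun i j : Fin 2 ↦
      ((padicValRat (![2, 3] j) (![(-16 : ℚ), 72] i ^ 2 * ![(80 : ℚ), -648] i - (((1 : ℤ) : ℚ)) * ((((-8 : ℤ) : ℚ)) + (((1 : ℤ) : ℚ))) * ![(-16 : ℚ), 72] i ^ 3 + (((1 : ℤ) : ℚ)) ^ 3 * (2 * (((-8 : ℤ) : ℚ)) + (((1 : ℤ) : ℚ))) * ![(-16 : ℚ), 72] i * ![(80 : ℚ), -648] i - (((-8 : ℤ) : ℚ)) ^ 2 * (((1 : ℤ) : ℚ)) ^ 4 * ![(-16 : ℚ), 72] i ^ 2 + (((-8 : ℤ) : ℚ)) ^ 2 * (((1 : ℤ) : ℚ)) ^ 6 * ![(80 : ℚ), -648] i) -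
        padicValRat (![2, 3] j) ((-576 : ℚ) ^ 2 * (-41472) - (((1 : ℤ) : ℚ)) * ((((-8 : ℤ) : ℚ)) + (((1 : ℤ) : ℚ))) * (-576 : ℚ) ^ 3 + (((1 : ℤ) : ℚ)) ^ 3 * (2 * (((-8 : ℤ) : ℚ)) + (((1 : ℤ) : ℚ))) * (-576 : ℚ) * (-41472) - (((-8 : ℤ) : ℚ)) ^ 2 * (((1 : ℤ) : ℚ)) ^ 4 * (-576 : ℚ) ^ 2 + (((-8 : ℤ) : ℚ)) ^ 2 * (((1 : ℤ) : ℚ)) ^ 6 * (-41472)) : ℤ) : ZMod 7)) =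
      !![4, 4; 2, 5] := by
    ext i j
    simp only [Matrix.of_apply]
    rw [kummerValues.1 i, kummerValues.2, valuations.1 i j, valuations.2 j]
    fin_cases i <;> fin_cases j <;> decide
  have hinv : (!![1, 2; 1, 5] : Matrix (Fin 2) (Fin 2) (ZMod 7)) *
      !![4, 4; 2, 5] = 1 := by decide
  intro e
  refine ⟨Matrix.vecMul e !![1, 2; 1, 5], ?_⟩
  rw [hM, Matrix.vecMul_vecMul, hinv, Matrix.vecMul_one]

/-- `S` is enumerated by `![2, 3]`. [folklore] -/
private theorem primeFactors_enum :
    (∀ j : Fin 2, ![2, 3] j ∈ ((-8 : ℤ) * 1 * (-8 - 1)).natAbs.primeFactors) ∧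
    (∀ p ∈ ((-8 : ℤ) * 1 * (-8 - 1)).natAbs.primeFactors, ∃ j : Fin 2, ![2, 3] j = p) := by
  refine ⟨fun j ↦ ?_, fun p hp ↦ ?_⟩
  · rw [primeFactors_eq]; fin_cases j <;> simp
  · rw [primeFactors_eq] at hp
    simp only [Finset.mem_insert, Finset.mem_singleton] at hp
    rcases hp with rfl | rfl
    · exact ⟨0, rfl⟩
    · exact ⟨1, rfl⟩

/-! ## §4 The theorems -/

/-- **`t₇(E_{-8}) = 0`: `corank_{ℤ₇} Ш(E_{-8}/ℚ)[7^∞] = 0`, UNCONDITIONALLY**, by the complete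
`7`-descent (`μ₇`-side box criterion of `KubertTateSevenMuDescent`, tame régime, `2` points, rank `1`).
[cite: SilvermanAEC2009, Thm. X.4.2(a)] [cite: Fisher2001FiveSevenDescent, §2] -/
theorem shaCorank_seven_eq_zero :
    haveI := isElliptic
    (kubertTateSeven (((-8 : ℤ) : ℚ)) (((1 : ℤ) : ℚ))).shaCorank 7 = 0 := by
  haveI := isElliptic
  haveI : Fact (Nat.Prime 5) := ⟨Nat.prime_five⟩
  obtain ⟨h1, h2, hb⟩ := nonsingular_points
  exact KubertTateSevenMuDescent.shaCorank_seven_eq_zero_of_matrix (-8) 1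
    (toGeomPoints _ (.some (-16) (80) h1)) (fun σ ↦ smul_toGeomPoints _ σ _)
    (KubertTateSevenTorsion.fortynine_zsmul_toGeomPoints_ne_zero (-8) 1 5 (by norm_num) (by norm_num)
      not_tor_dvd_Δ (by norm_num) (by norm_num) (by norm_num))
    not_seven_dvd_Δ tame ![2, 3] primeFactors_enum.1 primeFactors_enum.2
    ![(-16 : ℚ), 72] ![(80 : ℚ), -648]
    (fun i ↦ by fin_cases i <;> assumption)
    (fun i ↦ by fin_cases i <;> norm_num)
    (-576) (-41472) hb (by norm_num) matrix_surjective

/-- **`Ш(E_{-8}/ℚ)[7] = 0`, unconditionally.** [cite: SilvermanAEC2009, Thm. X.4.2(a)] -/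
theorem sha_torsionBy_seven_eq_bot :
    haveI := isElliptic
    (kubertTateSeven (((-8 : ℤ) : ℚ)) (((1 : ℤ) : ℚ))).sha[((7 : ℕ) : ℤ)] = ⊥ := by
  haveI := isElliptic
  haveI : Fact (Nat.Prime 5) := ⟨Nat.prime_five⟩
  obtain ⟨h1, h2, hb⟩ := nonsingular_points
  exact KubertTateSevenMuDescent.sha_torsionBy_seven_eq_bot_of_matrix (-8) 1
    (toGeomPoints _ (.some (-16) (80) h1)) (fun σ ↦ smul_toGeomPoints _ σ _)
    (KubertTateSevenTorsion.fortynine_zsmul_toGeomPoints_ne_zero (-8) 1 5 (by norm_num) (by norm_num)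
      not_tor_dvd_Δ (by norm_num) (by norm_num) (by norm_num))
    not_seven_dvd_Δ tame ![2, 3] primeFactors_enum.1 primeFactors_enum.2
    ![(-16 : ℚ), 72] ![(80 : ℚ), -648]
    (fun i ↦ by fin_cases i <;> assumption)
    (fun i ↦ by fin_cases i <;> norm_num)
    (-576) (-41472) hb (by norm_num) matrix_surjective

/-- **`Ш(E_{-8}/ℚ)[7^∞] = 0`, unconditionally.** [cite: SilvermanAEC2009, Thm. X.4.2(a)] -/
theorem primaryComponent_sha_seven_eq_bot :
    haveI := isElliptic
    AddCommGroup.primaryComponent (kubertTateSeven (((-8 : ℤ) : ℚ)) (((1 : ℤ) : ℚ))).sha 7 = ⊥ := by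
  haveI := isElliptic
  haveI : Fact (Nat.Prime 5) := ⟨Nat.prime_five⟩
  obtain ⟨h1, h2, hb⟩ := nonsingular_points
  exact KubertTateSevenMuDescent.primaryComponent_sha_seven_eq_bot_of_matrix (-8) 1
    (toGeomPoints _ (.some (-16) (80) h1)) (fun σ ↦ smul_toGeomPoints _ σ _)
    (KubertTateSevenTorsion.fortynine_zsmul_toGeomPoints_ne_zero (-8) 1 5 (by norm_num) (by norm_num)
      not_tor_dvd_Δ (by norm_num) (by norm_num) (by norm_num))
    not_seven_dvd_Δ tame ![2, 3] primeFactors_enum.1 primeFactors_enum.2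
    ![(-16 : ℚ), 72] ![(80 : ℚ), -648]
    (fun i ↦ by fin_cases i <;> assumption)
    (fun i ↦ by fin_cases i <;> norm_num)
    (-576) (-41472) hb (by norm_num) matrix_surjective

/-- **`rank E_{-8}(ℚ) = 1`, unconditionally** (the `7`-descent computes the rank: box full, tame,
`#E(ℚ)[7] = 7` by reduction modulo `5`). [cite: SilvermanAEC2009, Thm. X.4.2 and Thm. X.1.1] -/
theorem mordellWeilRank_eq :
    haveI := isElliptic
    (kubertTateSeven (((-8 : ℤ) : ℚ)) (((1 : ℤ) : ℚ))).mordellWeilRank = 1 := by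
  haveI := isElliptic
  haveI : Fact (Nat.Prime 5) := ⟨Nat.prime_five⟩
  obtain ⟨h1, h2, hb⟩ := nonsingular_points
  have h := KubertTateSevenMuDescent.mordellWeilRank_succ_eq_of_matrix (-8) 1
    (toGeomPoints _ (.some (-16) (80) h1)) (fun σ ↦ smul_toGeomPoints _ σ _)
    (KubertTateSevenTorsion.fortynine_zsmul_toGeomPoints_ne_zero (-8) 1 5 (by norm_num) (by norm_num)
      not_tor_dvd_Δ (by norm_num) (by norm_num) (by norm_num))
    not_seven_dvd_Δ tame ![2, 3] primeFactors_enum.1 primeFactors_enum.2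
    ![(-16 : ℚ), 72] ![(80 : ℚ), -648]
    (fun i ↦ by fin_cases i <;> assumption)
    (fun i ↦ by fin_cases i <;> norm_num)
    (-576) (-41472) hb (by norm_num) matrix_surjective
    (KubertTateSevenTorsion.natCard_torsionBy_seven (-8) 1 5 (by norm_num) (by norm_num) not_tor_dvd_Δ)
  have hc : (((-8 : ℤ) * 1 * (-8 - 1)).natAbs.primeFactors).card = 2 := by
    rw [primeFactors_eq]; decide
  omega

end KubertTateM81Descent

end Literature.NumberTheory.EllipticCurves

end
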